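import Literature.MathematicalPhysics.QuantumLattice.MatsubaraTruncationConvergence
import Literature.MathematicalPhysics.QuantumLattice.PropMatrixUniformDeterminantBound
import HarnessLib

/-!
# The free propagator kernel as the `M → ∞` limit of truncated Matsubara sums of the resolvent

Topic `Literature/MathematicalPhysics/QuantumLattice`; the matrix form of the `M → ∞` ("Matsubara UV")
bridge, joining the two descriptions of the free imaginary-time propagator of a quasi-free lattice fermion
system with Hermitian one-body matrix `h`:

* Hamiltonian side (`FermionQuasiFreeDynamics`, `PropMatrixUniformDeterminantBound`): the Gibbs state of
  `dΓ(h)` has `⟨a⁻_j(τ) a⁺_k(0)⟩_β = [e^{-τh}(1 + e^{-βh})⁻¹]_{jk}` (`0 < τ < β`) and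
  `⟨a⁺_k(0) a⁻_j(τ)⟩_β = [e^{-τh}(1 + e^{βh})⁻¹]_{jk}`, the entries of the tree's `propMatrix`;
* Grassmann side (`HubbardFreeCovariance`, BGM 2006 (2.3)): with `2M` fermionic Matsubara frequencies the
  covariance is the RESOLVENT `(-iω + h)⁻¹`, and the position–time propagator is the truncated sum
  `(1/β) Σᵢ e^{-iωᵢτ} [(-iωᵢ + h)⁻¹]_{jk}`.

PROVED here, for Hermitian `h` and `β > 0`:

* `Matrix.IsHermitian.resolvent_matsubara_eq_conj_diagonal`, `…_apply` — spectral form of the resolvent,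
  `[(-iω + h)⁻¹]_{jk} = Σₘ U_{jm} conj(U_{km})/(-iω + dₘ)` (`ω ≠ 0` real);
* **`Matrix.IsHermitian.tendsto_matsubara_resolvent_apply_of_mem_Ioo`** — for `0 < τ < β`,
  `(1/β) Σᵢ e^{-iωᵢτ}[(-iωᵢ + h)⁻¹]_{jk} → [e^{-τh}(1 + e^{-βh})⁻¹]_{jk}`;
  `…_of_mem_Ioo_neg` — for `-β < τ < 0` the limit is `-[e^{-τh}(1 + e^{βh})⁻¹]_{jk}` (the fermionic sign
  of time ordering); `…tendsto_matsubara_resolvent_apply_zero` — at `τ = 0`, the midpoint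
  `[½·1 − (1 + e^{βh})⁻¹]_{jk}`;
* `Matrix.IsHermitian.norm_matsubara_resolvent_sum_le` — the uniform bound `2 + βD/3` whenever all
  eigenvalues satisfy `|dₘ| ≤ D` (all `M`, all real `τ`).

Mode by mode this is `MatsubaraTruncationConvergence.tendsto_truncatedPropagator_bgm_of_mem_Ioo(_neg)` and
`MatsubaraTruncationMidpoint.tendsto_truncatedTadpole_bgm`; the assembly is the spectral theorem
(`Matrix.IsHermitian.propagatorKernel_apply`).  Everything is proved; no definitions, no named facts.

## Sources

G. Benfatto, A. Giuliani, V. Mastropietro, Ann. Henri Poincaré 7 (2006) 809–898, §1.2 (1.4), §2.1 (2.3)–(2.4),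
(2.6)–(2.8) ("standard arguments show that `Tr e^{-βH}/Tr e^{-βH₀} = lim_{M→∞} ∫P(dψ)e^{-V}`")
[`BenfattoGiulianiMastropietro2006`]; O. Bratteli, D. W. Robinson, *Operator Algebras and Quantum Statistical
Mechanics 2*, §5.2.4 [`BratteliRobinsonII1997`]. [folklore]
-/

noncomputable section

open scoped Matrix ComplexOrder Real
open Finset Filter Complex NormedSpace _root_.Topology Literature.MathematicalPhysics.QuantumLattice

namespace Matrix

variable {ι : Type*} [Fintype ι] [DecidableEq ι]

/-! ### Spectral form of the resolvent -/

omit [Fintype ι] in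
/-- `diag(c, …, c) = c • 1`. [folklore] -/
theorem diagonal_const_eq_smul_one (c : ℂ) : (diagonal fun _ : ι => c) = c • (1 : Matrix ι ι ℂ) := by
  ext i j
  by_cases hij : i = j
  · subst hij; simp
  · simp [hij]

/-- `c • 1 + U diag(f) U⋆ = U diag(c + f) U⋆` for unitary `U`. [folklore] -/
theorem smul_one_add_conj_diagonal {U : Matrix ι ι ℂ} (hU : U ∈ unitary (Matrix ι ι ℂ)) (c : ℂ) (f : ι → ℂ) :
    c • (1 : Matrix ι ι ℂ) + U * diagonal f * star U = U * diagonal (fun i => c + f i) * star U := by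
  have h1 : U * diagonal (fun _ : ι => c) * star U = c • (1 : Matrix ι ι ℂ) := by
    rw [diagonal_const_eq_smul_one, Matrix.mul_smul, Matrix.mul_one, Matrix.smul_mul,
      Unitary.mul_star_self_of_mem hU]
  rw [← h1, ← Matrix.add_mul, ← Matrix.mul_add, diagonal_add]

/-- `-iω + d ≠ 0` for real `ω ≠ 0` and real `d`. [folklore] -/
theorem neg_I_mul_add_ofReal_ne_zero {ω : ℝ} (hω : ω ≠ 0) (d : ℝ) : -(I * (ω : ℂ)) + d ≠ 0 := by
  intro h
  have := congrArg Complex.im h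
  simp at this
  exact hω this

/-- **The resolvent at a Matsubara frequency in the eigenbasis**: for Hermitian `h = U diag(d) U⋆` and real
`ω ≠ 0`, `(-iω·1 + h)⁻¹ = U diag(1/(-iω + dₘ)) U⋆`. [folklore] -/
theorem IsHermitian.resolvent_matsubara_eq_conj_diagonal {h : Matrix ι ι ℂ} (hh : h.IsHermitian) {ω : ℝ}
    (hω : ω ≠ 0) :
    ((-(I * ω)) • (1 : Matrix ι ι ℂ) + h)⁻¹ = (hh.eigenvectorUnitary : Matrix ι ι ℂ) *
      diagonal (fun m => 1 / (-(I * ω) + (hh.eigenvalues m : ℂ))) * star (hh.eigenvectorUnitary : Matrix ι ι ℂ) := by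
  have hU : (hh.eigenvectorUnitary : Matrix ι ι ℂ) ∈ unitary (Matrix ι ι ℂ) := hh.eigenvectorUnitary.prop
  have hsum : (-(I * ω)) • (1 : Matrix ι ι ℂ) + h = (hh.eigenvectorUnitary : Matrix ι ι ℂ) *
      diagonal (fun m => -(I * ω) + (hh.eigenvalues m : ℂ)) * star (hh.eigenvectorUnitary : Matrix ι ι ℂ) := by
    calc (-(I * ω)) • (1 : Matrix ι ι ℂ) + h
        = (-(I * ω)) • (1 : Matrix ι ι ℂ) + (hh.eigenvectorUnitary : Matrix ι ι ℂ) *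
            diagonal (fun m => (hh.eigenvalues m : ℂ)) * star (hh.eigenvectorUnitary : Matrix ι ι ℂ) := by
          rw [← hh.eq_conj_diagonal]
      _ = _ := smul_one_add_conj_diagonal hU _ _
  refine Matrix.inv_eq_left_inv ?_
  rw [hsum, conj_diagonal_mul_conj_diagonal hU]
  have hfun : (fun m => 1 / (-(I * ω) + (hh.eigenvalues m : ℂ)) * (-(I * ω) + (hh.eigenvalues m : ℂ))) =
      fun _ => (1 : ℂ) := by
    funext m
    rw [one_div, inv_mul_cancel₀ (neg_I_mul_add_ofReal_ne_zero hω _)]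
  rw [hfun, diagonal_one, Matrix.mul_one, Unitary.mul_star_self_of_mem hU]

/-- Entries of the resolvent: `[(-iω + h)⁻¹]_{jk} = Σₘ U_{jm} (1/(-iω + dₘ)) conj(U_{km})`. [folklore] -/
theorem IsHermitian.resolvent_matsubara_apply {h : Matrix ι ι ℂ} (hh : h.IsHermitian) {ω : ℝ} (hω : ω ≠ 0)
    (j k : ι) :
    ((-(I * ω)) • (1 : Matrix ι ι ℂ) + h)⁻¹ j k = ∑ m, (hh.eigenvectorUnitary : Matrix ι ι ℂ) j m *
      (1 / (-(I * ω) + (hh.eigenvalues m : ℂ))) * star ((hh.eigenvectorUnitary : Matrix ι ι ℂ) k m) := by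
  rw [hh.resolvent_matsubara_eq_conj_diagonal hω, conj_diagonal_apply]

/-! ### The truncated Matsubara sums of the resolvent -/

/-- **Mode decomposition of the truncated sum**:
`(1/β) Σᵢ e^{-iωᵢτ}[(-iωᵢ + h)⁻¹]_{jk} = Σₘ U_{jm} conj(U_{km}) · (1/β) Σᵢ e^{-iωᵢτ}/(-iωᵢ + dₘ)` (`β ≠ 0`).
[folklore] -/
theorem IsHermitian.matsubara_resolvent_sum_eq {h : Matrix ι ι ℂ} (hh : h.IsHermitian) {β : ℝ} (hβ : β ≠ 0)
    (τ : ℝ) (M : ℕ) (j k : ι) :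
    (1 / (β : ℂ)) * ∑ i : MatsubaraIdx M, cexp (-(I * matsubaraFreq β M i * τ)) *
        ((-(I * matsubaraFreq β M i)) • (1 : Matrix ι ι ℂ) + h)⁻¹ j k =
      ∑ m, (hh.eigenvectorUnitary : Matrix ι ι ℂ) j m * star ((hh.eigenvectorUnitary : Matrix ι ι ℂ) k m) *
        ((1 / (β : ℂ)) * ∑ i : MatsubaraIdx M, cexp (-(I * matsubaraFreq β M i * τ)) *
          (1 / (-(I * matsubaraFreq β M i) + (hh.eigenvalues m : ℂ)))) := by
  have hrw : ∀ i : MatsubaraIdx M, cexp (-(I * matsubaraFreq β M i * τ)) *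
      ((-(I * matsubaraFreq β M i)) • (1 : Matrix ι ι ℂ) + h)⁻¹ j k =
      ∑ m, (hh.eigenvectorUnitary : Matrix ι ι ℂ) j m * star ((hh.eigenvectorUnitary : Matrix ι ι ℂ) k m) *
        (cexp (-(I * matsubaraFreq β M i * τ)) * (1 / (-(I * matsubaraFreq β M i) + (hh.eigenvalues m : ℂ)))) := by
    intro i
    rw [hh.resolvent_matsubara_apply (matsubaraFreq_ne_zero hβ i), Finset.mul_sum]
    refine Finset.sum_congr rfl fun m _ => ?_
    ring
  rw [Finset.sum_congr rfl fun i _ => hrw i, Finset.sum_comm]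
  simp only [Finset.mul_sum]
  refine Finset.sum_congr rfl fun m _ => Finset.sum_congr rfl fun i _ => ?_
  ring

/-- **The Matsubara representation of the free propagator, `0 < τ < β`**: for Hermitian `h` and `β > 0`,
`(1/β) Σᵢ e^{-iωᵢτ}[(-iωᵢ + h)⁻¹]_{jk} → [e^{-τh}(1 + e^{-βh})⁻¹]_{jk} = ⟨a⁻_j(τ) a⁺_k(0)⟩_β` as `M → ∞`
(BGM 2006 (2.3)–(2.4) with (1.4); the `x₀ > y₀` branch of the time-ordered propagator of `dΓ(h)`,
`FermionQuasiFreeDynamics.thermalCorr_dGamma_evolve_annihilation_creation`).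
[cite: BenfattoGiulianiMastropietro2006, §2.1 (2.3)-(2.4)] -/
theorem IsHermitian.tendsto_matsubara_resolvent_apply_of_mem_Ioo {h : Matrix ι ι ℂ} (hh : h.IsHermitian)
    {β : ℝ} (hβ : 0 < β) {τ : ℝ} (hτ : τ ∈ Set.Ioo 0 β) (j k : ι) :
    Tendsto (fun M : ℕ => (1 / (β : ℂ)) * ∑ i : MatsubaraIdx M, cexp (-(I * matsubaraFreq β M i * τ)) *
        ((-(I * matsubaraFreq β M i)) • (1 : Matrix ι ι ℂ) + h)⁻¹ j k)
      atTop (𝓝 ((NormedSpace.exp (-((τ : ℂ) • h)) * (1 + NormedSpace.exp (-((β : ℂ) • h)))⁻¹) j k)) := by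
  have hker := hh.propagatorKernel_apply 0 τ (-β) j k
  rw [Complex.ofReal_zero, zero_smul, NormedSpace.exp_zero, Matrix.mul_one, Complex.ofReal_neg, neg_smul] at hker
  rw [hker]
  have hlim : Tendsto (fun M : ℕ => ∑ m, (hh.eigenvectorUnitary : Matrix ι ι ℂ) j m *
      star ((hh.eigenvectorUnitary : Matrix ι ι ℂ) k m) *
        ((1 / (β : ℂ)) * ∑ i : MatsubaraIdx M, cexp (-(I * matsubaraFreq β M i * τ)) *
          (1 / (-(I * matsubaraFreq β M i) + (hh.eigenvalues m : ℂ))))) atTop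
      (𝓝 (∑ m, (hh.eigenvectorUnitary : Matrix ι ι ℂ) j m * star ((hh.eigenvectorUnitary : Matrix ι ι ℂ) k m) *
        ((((1 + Real.exp (-(β * hh.eigenvalues m)))⁻¹ * Real.exp (-(hh.eigenvalues m * τ))) : ℝ) : ℂ))) :=
    tendsto_finsetSum _ fun m _ => (tendsto_truncatedPropagator_bgm_of_mem_Ioo hβ (hh.eigenvalues m) hτ).const_mul _
  have hval : ∀ m, (1 + Real.exp (-(β * hh.eigenvalues m)))⁻¹ * Real.exp (-(hh.eigenvalues m * τ)) =
      Real.exp ((0 - τ) * hh.eigenvalues m) * (1 + Real.exp (-β * hh.eigenvalues m))⁻¹ := by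
    intro m
    rw [show (0 - τ) * hh.eigenvalues m = -(hh.eigenvalues m * τ) by ring,
      show -β * hh.eigenvalues m = -(β * hh.eigenvalues m) by ring, mul_comm]
  simp only [hval] at hlim
  refine hlim.congr fun M => ?_
  rw [hh.matsubara_resolvent_sum_eq hβ.ne' τ M j k]

/-- **The Matsubara representation of the free propagator, `-β < τ < 0`**:
`(1/β) Σᵢ e^{-iωᵢτ}[(-iωᵢ + h)⁻¹]_{jk} → -[e^{-τh}(1 + e^{βh})⁻¹]_{jk} = -⟨a⁺_k(0) a⁻_j(τ)⟩_β` as `M → ∞`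
(the `x₀ ≤ y₀` branch with its fermionic sign; `thermalCorr_dGamma_evolve_creation_annihilation`).
[cite: BenfattoGiulianiMastropietro2006, §2.1 (2.3)-(2.4)] -/
theorem IsHermitian.tendsto_matsubara_resolvent_apply_of_mem_Ioo_neg {h : Matrix ι ι ℂ} (hh : h.IsHermitian)
    {β : ℝ} (hβ : 0 < β) {τ : ℝ} (hτ : τ ∈ Set.Ioo (-β) 0) (j k : ι) :
    Tendsto (fun M : ℕ => (1 / (β : ℂ)) * ∑ i : MatsubaraIdx M, cexp (-(I * matsubaraFreq β M i * τ)) *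
        ((-(I * matsubaraFreq β M i)) • (1 : Matrix ι ι ℂ) + h)⁻¹ j k)
      atTop (𝓝 (-((NormedSpace.exp (-((τ : ℂ) • h)) * (1 + NormedSpace.exp ((β : ℂ) • h))⁻¹) j k))) := by
  have hker := hh.propagatorKernel_apply 0 τ β j k
  rw [Complex.ofReal_zero, zero_smul, NormedSpace.exp_zero, Matrix.mul_one] at hker
  rw [hker, ← Finset.sum_neg_distrib]
  have hlim : Tendsto (fun M : ℕ => ∑ m, (hh.eigenvectorUnitary : Matrix ι ι ℂ) j m *
      star ((hh.eigenvectorUnitary : Matrix ι ι ℂ) k m) *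
        ((1 / (β : ℂ)) * ∑ i : MatsubaraIdx M, cexp (-(I * matsubaraFreq β M i * τ)) *
          (1 / (-(I * matsubaraFreq β M i) + (hh.eigenvalues m : ℂ))))) atTop
      (𝓝 (∑ m, (hh.eigenvectorUnitary : Matrix ι ι ℂ) j m * star ((hh.eigenvectorUnitary : Matrix ι ι ℂ) k m) *
        (((-((1 + Real.exp (β * hh.eigenvalues m))⁻¹ * Real.exp (-(hh.eigenvalues m * τ)))) : ℝ) : ℂ))) :=
    tendsto_finsetSum _ fun m _ =>
      (tendsto_truncatedPropagator_bgm_of_mem_Ioo_neg hβ (hh.eigenvalues m) hτ).const_mul _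
  have hval : ∀ m, (1 + Real.exp (β * hh.eigenvalues m))⁻¹ * Real.exp (-(hh.eigenvalues m * τ)) =
      Real.exp ((0 - τ) * hh.eigenvalues m) * (1 + Real.exp (β * hh.eigenvalues m))⁻¹ := by
    intro m
    rw [show (0 - τ) * hh.eigenvalues m = -(hh.eigenvalues m * τ) by ring, mul_comm]
  simp only [hval, Complex.ofReal_neg, mul_neg] at hlim
  refine hlim.congr fun M => ?_
  rw [hh.matsubara_resolvent_sum_eq hβ.ne' τ M j k]

/-- **The Matsubara representation at equal times** (`τ = 0`, no convergence factor): for Hermitian `h` and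
`β > 0`, `(1/β) Σᵢ [(-iωᵢ + h)⁻¹]_{jk} → [½·1 − (1 + e^{βh})⁻¹]_{jk}`, the MIDPOINT
`½(⟨a⁻_j a⁺_k⟩ − ⟨a⁺_k a⁻_j⟩)` of the two branches (mode by mode `tendsto_truncatedTadpole_bgm`).
[cite: GiulianiMastropietro2010, App. A (A.19)-(A.21)] -/
theorem IsHermitian.tendsto_matsubara_resolvent_apply_zero {h : Matrix ι ι ℂ} (hh : h.IsHermitian)
    {β : ℝ} (hβ : 0 < β) (j k : ι) :
    Tendsto (fun M : ℕ => (1 / (β : ℂ)) * ∑ i : MatsubaraIdx M,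
        ((-(I * matsubaraFreq β M i)) • (1 : Matrix ι ι ℂ) + h)⁻¹ j k)
      atTop (𝓝 (((1 / 2 : ℂ) • (1 : Matrix ι ι ℂ) - (1 + NormedSpace.exp ((β : ℂ) • h))⁻¹) j k)) := by
  have hU : (hh.eigenvectorUnitary : Matrix ι ι ℂ) ∈ unitary (Matrix ι ι ℂ) := hh.eigenvectorUnitary.prop
  -- the target entry in the eigenbasis
  have hneg : -((hh.eigenvectorUnitary : Matrix ι ι ℂ) *
      diagonal (fun i => (((1 + Real.exp (β * hh.eigenvalues i))⁻¹ : ℝ) : ℂ)) *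
        star (hh.eigenvectorUnitary : Matrix ι ι ℂ)) =
      (hh.eigenvectorUnitary : Matrix ι ι ℂ) *
        diagonal (fun i => -(((1 + Real.exp (β * hh.eigenvalues i))⁻¹ : ℝ) : ℂ)) *
          star (hh.eigenvectorUnitary : Matrix ι ι ℂ) := by
    rw [← diagonal_neg, Matrix.mul_neg, Matrix.neg_mul]
  have htarget : ((1 / 2 : ℂ) • (1 : Matrix ι ι ℂ) - (1 + NormedSpace.exp ((β : ℂ) • h))⁻¹) j k =
      ∑ m, (hh.eigenvectorUnitary : Matrix ι ι ℂ) j m * star ((hh.eigenvectorUnitary : Matrix ι ι ℂ) k m) *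
        (((1 / 2 - (1 + Real.exp (β * hh.eigenvalues m))⁻¹) : ℝ) : ℂ) := by
    rw [hh.inv_one_add_exp_real_smul_eq_conj_diagonal β, sub_eq_add_neg, hneg, smul_one_add_conj_diagonal hU,
      conj_diagonal_apply]
    refine Finset.sum_congr rfl fun m _ => ?_
    push_cast
    ring
  rw [htarget]
  have hlim : Tendsto (fun M : ℕ => ∑ m, (hh.eigenvectorUnitary : Matrix ι ι ℂ) j m *
      star ((hh.eigenvectorUnitary : Matrix ι ι ℂ) k m) *
        ((1 / (β : ℂ)) * ∑ i : MatsubaraIdx M, (1 / (-(I * matsubaraFreq β M i) + (hh.eigenvalues m : ℂ))))) atTop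
      (𝓝 (∑ m, (hh.eigenvectorUnitary : Matrix ι ι ℂ) j m * star ((hh.eigenvectorUnitary : Matrix ι ι ℂ) k m) *
        (((1 / 2 - (1 + Real.exp (β * hh.eigenvalues m))⁻¹) : ℝ) : ℂ))) :=
    tendsto_finsetSum _ fun m _ => (tendsto_truncatedTadpole_bgm hβ (hh.eigenvalues m)).const_mul _
  refine hlim.congr fun M => ?_
  have h0 := hh.matsubara_resolvent_sum_eq hβ.ne' 0 M j k
  simp only [Complex.ofReal_zero, mul_zero, neg_zero, Complex.exp_zero, one_mul] at h0
  rw [h0]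

/-! ### The uniform bound -/

/-- `Σₘ ‖U_{jm}‖ ‖U_{km}‖ ≤ 1` for unitary `U` (AM–GM and unit rows). [folklore] -/
theorem sum_norm_mul_norm_le_one {U : Matrix ι ι ℂ} (hU : U ∈ unitary (Matrix ι ι ℂ)) (j k : ι) :
    ∑ m, ‖U j m‖ * ‖U k m‖ ≤ 1 := by
  have hj := sum_norm_sq_row_eq_one hU j
  have hk := sum_norm_sq_row_eq_one hU k
  calc ∑ m, ‖U j m‖ * ‖U k m‖ ≤ ∑ m, (‖U j m‖ ^ 2 + ‖U k m‖ ^ 2) / 2 :=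
        Finset.sum_le_sum fun m _ => by nlinarith [sq_nonneg (‖U j m‖ - ‖U k m‖)]
    _ = 1 := by rw [← Finset.sum_div, Finset.sum_add_distrib, hj, hk]; norm_num

/-- **Uniform bound on the truncated Matsubara sums of the resolvent**: if all eigenvalues of the Hermitian `h`
satisfy `|dₘ| ≤ D` then `‖(1/β) Σᵢ e^{-iωᵢτ}[(-iωᵢ + h)⁻¹]_{jk}‖ ≤ 2 + βD/3` for every `M` and every real `τ`
(`β > 0`; mode by mode `norm_truncatedPropagator_bgm_le`). [folklore] -/
theorem IsHermitian.norm_matsubara_resolvent_sum_le {h : Matrix ι ι ℂ} (hh : h.IsHermitian) {β : ℝ}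
    (hβ : 0 < β) {D : ℝ} (hD : ∀ m, |hh.eigenvalues m| ≤ D) (τ : ℝ) (M : ℕ) (j k : ι) :
    ‖(1 / (β : ℂ)) * ∑ i : MatsubaraIdx M, cexp (-(I * matsubaraFreq β M i * τ)) *
        ((-(I * matsubaraFreq β M i)) • (1 : Matrix ι ι ℂ) + h)⁻¹ j k‖ ≤ 2 + β * D / 3 := by
  have hU : (hh.eigenvectorUnitary : Matrix ι ι ℂ) ∈ unitary (Matrix ι ι ℂ) := hh.eigenvectorUnitary.prop
  rw [hh.matsubara_resolvent_sum_eq hβ.ne' τ M j k]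
  have hD0 : 0 ≤ D := (abs_nonneg _).trans (hD j)
  have hmode : ∀ m, ‖(1 / (β : ℂ)) * ∑ i : MatsubaraIdx M, cexp (-(I * matsubaraFreq β M i * τ)) *
      (1 / (-(I * matsubaraFreq β M i) + (hh.eigenvalues m : ℂ)))‖ ≤ 2 + β * D / 3 := fun m =>
    (norm_truncatedPropagator_bgm_le hβ (hh.eigenvalues m) τ M).trans (by gcongr; exact hD m)
  calc ‖∑ m, (hh.eigenvectorUnitary : Matrix ι ι ℂ) j m * star ((hh.eigenvectorUnitary : Matrix ι ι ℂ) k m) *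
        ((1 / (β : ℂ)) * ∑ i : MatsubaraIdx M, cexp (-(I * matsubaraFreq β M i * τ)) *
          (1 / (-(I * matsubaraFreq β M i) + (hh.eigenvalues m : ℂ))))‖
      ≤ ∑ m, ‖(hh.eigenvectorUnitary : Matrix ι ι ℂ) j m‖ * ‖(hh.eigenvectorUnitary : Matrix ι ι ℂ) k m‖ *
          (2 + β * D / 3) := by
        refine (norm_sum_le _ _).trans (Finset.sum_le_sum fun m _ => ?_)
        rw [norm_mul, norm_mul, norm_star]
        exact mul_le_mul_of_nonneg_left (hmode m) (by positivity)
    _ = (∑ m, ‖(hh.eigenvectorUnitary : Matrix ι ι ℂ) j m‖ * ‖(hh.eigenvectorUnitary : Matrix ι ι ℂ) k m‖) *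
          (2 + β * D / 3) := by rw [Finset.sum_mul]
    _ ≤ 1 * (2 + β * D / 3) :=
        mul_le_mul_of_nonneg_right (sum_norm_mul_norm_le_one hU j k) (by positivity)
    _ = 2 + β * D / 3 := one_mul _

end Matrix
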